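import Summits.AtomisticToContinuum.Crystallization.Theorems.FrustratedLawDichotomyStrainedPatchHomLatticeBoxHcp

/-!
# Index-box enumeration for VECTOR integrands and WINDOWED lattice sums (the (P3) force-prune sums), both families
# (27623 strained-patch piece; decomp-a2c, prover hand 2, generation 20; critic row 765 (g2))

`…HomLatticeBox(Hcp)` enumerates `∑ᶠ v ∈ Λ ∖ 0, W ‖v‖` for RADIAL integrands.  The force prune (P3) of `…HomPrunes` uses a VECTOR integrand on a
WINDOW: `∑ᶠ v ∈ {v ≠ 0 ∧ ‖v‖ ≤ 7 ∧ v ∈ Λ}, V_LJ ‖q − v‖`.  This DEF-FREE module supplies: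

* §1 fcc, any integrand `F : E3 → ℝ` vanishing from radius `R`: `finsum_fcc_eq_boxSum` (box `[−K,K]³`, `8R² < 3(K+1)²`);
* §2 hcp, any such `F`: PARAMETRIC boxes `mem_box_of_norm_hexPt_lt'` (`‖P b‖ < ρ`, `4ρ² < 3(K+1)²`) and `mem_box_of_norm_hexPt_add_shift_lt'`
  (`‖P b + s‖ < ρ'`, `16ρ'² < 3(2K+1)²`), and `finsum_hcp_eq_boxSum` (`64R² < 27(K+1)²`, `16(4R/3 + 1/4)² < 3(2K+1)²`);
* §3 ★ the WINDOWED sums of (P3): `windowSum_fcc_eq_boxSum` / `windowSum_hcp_eq_boxSum` —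
  `∑ᶠ v ∈ {v ≠ 0 ∧ ‖v‖ ≤ 7 ∧ v ∈ Λ}, f v = Σ_{b ∈ [−11,11]³ ∖ 0, ‖latPt … b‖ ≤ 7} f (latPt … b)` (+ the shifted family for hcp), honest `K = 11`
  (radius `71/10 > 7`: `8·(71/10)² = 403.3 < 432`; hcp `3226 < 3888`, `1511 < 1587`), for ANY `f` — so the two sides of `not_realised_…_of_forceOut`'s
  inequality are finite sums of `V_LJ` values at explicit points.

0 sorry; no definitions; axioms ⊆ {propext, Classical.choice, Quot.sound}.  `--supports stmt-AtomisticToContinuum-27623`.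
-/

noncomputable section

namespace Summit.AtomisticToContinuum.Crystallization.Theorems.FrustratedLawDichotomyStrainedPatchHomLatticeBoxWindow

open scoped BigOperators Classical
open Summit.AtomisticToContinuum.Crystallization.Theorems.ChargedEnergyGapNegative (E3)
open Summit.AtomisticToContinuum.Crystallization.Theorems.FrustratedLawDichotomyStrainedPatchHomSplit
open Summit.AtomisticToContinuum.Crystallization.Theorems.FrustratedLawDichotomyStrainedPatchHomLattice
open Summit.AtomisticToContinuum.Crystallization.Theorems.FrustratedLawDichotomyStrainedPatchHomRelief
open Summit.AtomisticToContinuum.Crystallization.Theorems.FrustratedLawDichotomyStrainedPatchHomLatticeBox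
open Summit.AtomisticToContinuum.Crystallization.Theorems.FrustratedLawDichotomyStrainedPatchHomLatticeBoxHcp
open Literature.Barriers.AtomisticToContinuum.FlatleyTheil2015 (fccVec fccPoint)

/-! ## §1. fcc, any integrand vanishing from `R` -/

/-- ★ **fcc enumeration, VECTOR integrand**: for `F : E3 → ℝ` vanishing from `‖v‖ ≥ R` on and `8R² < 3(K+1)²`,
`∑ᶠ v ∈ G·L_fcc ∖ 0, F v = Σ_{b ∈ [−K,K]³ ∖ 0} F (latPt G fccVec b)` (`‖G − 1‖ ≤ 1/4`). [folklore] -/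
theorem finsum_fcc_eq_boxSum {G : E3 →L[ℝ] E3} (hG : ‖G - 1‖ ≤ 1 / 4) {F : E3 → ℝ} {R : ℝ} (hF : ∀ v : E3, R ≤ ‖v‖ → F v = 0)
    {K : ℕ} (hK : 8 * R ^ 2 < 3 * ((K : ℝ) + 1) ^ 2) :
    ∑ᶠ v ∈ {v : E3 | v ≠ 0 ∧ ∃ b : Fin 3 → ℤ, v = latPt G fccVec b}, F v =
      ∑ b ∈ (Fintype.piFinset fun _ : Fin 3 => Finset.Icc (-(K : ℤ)) K).filter (fun b => b ≠ 0), F (latPt G fccVec b) := by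
  have hinj := latPt_fcc_injective hG
  have hset : {v : E3 | v ≠ 0 ∧ ∃ b : Fin 3 → ℤ, v = latPt G fccVec b} = (latPt G fccVec) '' {b : Fin 3 → ℤ | b ≠ 0} := by
    ext v
    constructor
    · rintro ⟨hv, b, rfl⟩
      exact ⟨b, fun hb => hv (by rw [hb, latPt_zero]), rfl⟩
    · rintro ⟨b, hb, rfl⟩
      exact ⟨fun h => hb (hinj (by rw [h, latPt_zero])), b, rfl⟩
  rw [hset, finsum_mem_image hinj.injOn,
    finsum_mem_inter_support_eq' (fun b : Fin 3 → ℤ => F (latPt G fccVec b)) {b : Fin 3 → ℤ | b ≠ 0}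
      (↑((Fintype.piFinset fun _ : Fin 3 => Finset.Icc (-(K : ℤ)) K).filter (fun b => b ≠ 0))) ?_]
  · exact finsum_mem_coe_finset _ _
  · intro b hb
    have hlt : ‖latPt G fccVec b‖ < R := lt_of_not_ge fun h => hb (hF _ h)
    have hfp : ‖fccPoint b‖ < 4 / 3 * R := by
      have h34 := norm_apply_ge_of_near_one hG (fccPoint b)
      rw [← latPt_fccVec_eq] at h34
      linarith
    simp only [Finset.coe_filter, Set.mem_setOf_eq, mem_box_of_norm_fccPoint_lt hK hfp, true_and]

/-! ## §2. hcp, parametric boxes and any integrand vanishing from `R` -/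

/-- Integer bookkeeping: `x² < (K+1)²` for the real cast of an integer `n = x` puts `n` in `[−K, K]`. [arithmetic] -/
theorem mem_Icc_of_sq_lt {n : ℤ} {K : ℕ} (h : ((n : ℤ) : ℝ) ^ 2 < ((K : ℝ) + 1) ^ 2) : n ∈ Finset.Icc (-(K : ℤ)) K := by
  obtain ⟨hlo, hhi⟩ := abs_lt_of_sq_lt_sq' h (by positivity)
  have hlo' : -((K : ℤ) + 1) < n := by exact_mod_cast (by push_cast; linarith : (((-((K : ℤ) + 1) : ℤ)) : ℝ) < n)
  have hhi' : n < (K : ℤ) + 1 := by exact_mod_cast (by push_cast; linarith : ((n : ℤ) : ℝ) < (((K : ℤ) + 1 : ℤ) : ℝ))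
  exact Finset.mem_Icc.2 ⟨by omega, by omega⟩

/-- Integer bookkeeping, shifted: `(x + a)² < (K + 1/2)²` with `0 ≤ a ≤ 1/2` puts the integer `x` in `[−K, K]`. [arithmetic] -/
theorem mem_Icc_of_shifted_sq_lt {n : ℤ} {K : ℕ} {a : ℝ} (ha0 : 0 ≤ a) (ha1 : a ≤ 1 / 2)
    (h : (((n : ℤ) : ℝ) + a) ^ 2 < ((K : ℝ) + 1 / 2) ^ 2) : n ∈ Finset.Icc (-(K : ℤ)) K := by
  obtain ⟨hlo, hhi⟩ := abs_lt_of_sq_lt_sq' h (by positivity)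
  have hlo' : -((K : ℤ) + 1) < n := by exact_mod_cast (by push_cast; linarith : (((-((K : ℤ) + 1) : ℤ)) : ℝ) < n)
  have hhi' : n < (K : ℤ) + 1 := by exact_mod_cast (by push_cast; linarith : ((n : ℤ) : ℝ) < (((K : ℤ) + 1 : ℤ) : ℝ))
  exact Finset.mem_Icc.2 ⟨by omega, by omega⟩

/-- ★ **Parametric box, unshifted hcp family**: `‖P b‖ < ρ ∧ 4ρ² < 3(K+1)² ⟹ b ∈ [−K,K]³` (`¾bᵢ² ≤ ‖P b‖²` for `i = 1,2`, `(8/3)b₃² ≤ ‖P b‖²`). [folklore] -/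
theorem mem_box_of_norm_hexPt_lt' {b : Fin 3 → ℤ} {ρ : ℝ} {K : ℕ} (hK : 4 * ρ ^ 2 < 3 * ((K : ℝ) + 1) ^ 2)
    (hb : ‖latPt 1 hexFrame b‖ < ρ) : b ∈ Fintype.piFinset fun _ : Fin 3 => Finset.Icc (-(K : ℤ)) K := by
  have hn := norm_nonneg (latPt 1 hexFrame b)
  have hsq : ‖latPt 1 hexFrame b‖ ^ 2 < ρ ^ 2 := by nlinarith
  rw [norm_sq_hexPt] at hsq
  have h0 : ((b 0 : ℤ) : ℝ) ^ 2 < ((K : ℝ) + 1) ^ 2 := by nlinarith [sq_nonneg (((b 0 : ℤ) : ℝ) + 2 * b 1), sq_nonneg ((b 2 : ℤ) : ℝ)]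
  have h1 : ((b 1 : ℤ) : ℝ) ^ 2 < ((K : ℝ) + 1) ^ 2 := by nlinarith [sq_nonneg (2 * ((b 0 : ℤ) : ℝ) + b 1), sq_nonneg ((b 2 : ℤ) : ℝ)]
  have h2 : ((b 2 : ℤ) : ℝ) ^ 2 < ((K : ℝ) + 1) ^ 2 := by nlinarith [sq_nonneg (2 * ((b 0 : ℤ) : ℝ) + b 1), sq_nonneg ((b 1 : ℤ) : ℝ)]
  exact Fintype.mem_piFinset.2 fun i => by
    fin_cases i
    · exact mem_Icc_of_sq_lt h0
    · exact mem_Icc_of_sq_lt h1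
    · exact mem_Icc_of_sq_lt h2

/-- ★ **Parametric box, shifted hcp family**: `‖P b + hcpShift‖ < ρ' ∧ 16ρ'² < 3(2K+1)² ⟹ b ∈ [−K,K]³`
(`¾(bᵢ + 1/3)² ≤ ‖P b + s‖²` for `i = 1,2`, `(8/3)(b₃ + 1/2)² ≤ ‖P b + s‖²`). [folklore] -/
theorem mem_box_of_norm_hexPt_add_shift_lt' {b : Fin 3 → ℤ} {ρ' : ℝ} {K : ℕ} (hK : 16 * ρ' ^ 2 < 3 * (2 * (K : ℝ) + 1) ^ 2)
    (hb : ‖latPt 1 hexFrame b + hcpShift‖ < ρ') : b ∈ Fintype.piFinset fun _ : Fin 3 => Finset.Icc (-(K : ℤ)) K := by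
  have hn := norm_nonneg (latPt 1 hexFrame b + hcpShift)
  have hsq : ‖latPt 1 hexFrame b + hcpShift‖ ^ 2 < ρ' ^ 2 := by nlinarith
  rw [norm_sq_hexPt_add_shift] at hsq
  have hK' : 4 / 3 * ρ' ^ 2 < ((K : ℝ) + 1 / 2) ^ 2 := by nlinarith
  have h0 : (((b 0 : ℤ) : ℝ) + 1 / 3) ^ 2 < ((K : ℝ) + 1 / 2) ^ 2 := by
    nlinarith [sq_nonneg ((((b 0 : ℤ) : ℝ) + 1 / 3) / 2 + (b 1 + 1 / 3)), sq_nonneg (((b 2 : ℤ) : ℝ) + 1 / 2)]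
  have h1 : (((b 1 : ℤ) : ℝ) + 1 / 3) ^ 2 < ((K : ℝ) + 1 / 2) ^ 2 := by
    nlinarith [sq_nonneg (((b 0 : ℤ) : ℝ) + b 1 / 2 + 1 / 2), sq_nonneg (((b 2 : ℤ) : ℝ) + 1 / 2)]
  have h2 : (((b 2 : ℤ) : ℝ) + 1 / 2) ^ 2 < ((K : ℝ) + 1 / 2) ^ 2 := by
    nlinarith [sq_nonneg (((b 0 : ℤ) : ℝ) + b 1 / 2 + 1 / 2), sq_nonneg (((b 1 : ℤ) : ℝ) + 1 / 3)]
  exact Fintype.mem_piFinset.2 fun i => by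
    fin_cases i
    · exact mem_Icc_of_shifted_sq_lt (by norm_num) (by norm_num) h0
    · exact mem_Icc_of_shifted_sq_lt (by norm_num) (by norm_num) h1
    · exact mem_Icc_of_shifted_sq_lt (by norm_num) (by norm_num) h2

/-- ★ **hcp enumeration, VECTOR integrand, parametric radius/box**: `F` vanishing from `‖v‖ ≥ R`, `64R² < 27(K+1)²`,
`16(4R/3 + 1/4)² < 3(2K+1)²` ⟹ `∑ᶠ v ∈ T_A ∖ 0, F v = Σ_{b ∈ [−K,K]³ ∖ 0} F (latPt G hexFrame b) + Σ_{b ∈ [−K,K]³} F (latPt G hexFrame b + G (hcpShift + ξ))`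
(`‖G − 1‖ ≤ 1/4`, `‖ξ‖ ≤ 1/4`). [folklore] -/
theorem finsum_hcp_eq_boxSum {G : E3 →L[ℝ] E3} {ξ : E3} (hG : ‖G - 1‖ ≤ 1 / 4) (hξ : ‖ξ‖ ≤ 1 / 4) {F : E3 → ℝ} {R : ℝ}
    (hF : ∀ v : E3, R ≤ ‖v‖ → F v = 0) {K : ℕ} (hK1 : 64 * R ^ 2 < 27 * ((K : ℝ) + 1) ^ 2)
    (hK2 : 16 * (4 / 3 * R + 1 / 4) ^ 2 < 3 * (2 * (K : ℝ) + 1) ^ 2) :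
    ∑ᶠ v ∈ {v : E3 | v ≠ 0 ∧ ∃ b : Fin 3 → ℤ, v = latPt G hexFrame b ∨ v = latPt G hexFrame b + G (hcpShift + ξ)}, F v =
      ∑ b ∈ (Fintype.piFinset fun _ : Fin 3 => Finset.Icc (-(K : ℤ)) K).filter (fun b => b ≠ 0), F (latPt G hexFrame b) +
        ∑ b ∈ (Fintype.piFinset fun _ : Fin 3 => Finset.Icc (-(K : ℤ)) K), F (latPt G hexFrame b + G (hcpShift + ξ)) := by
  set box : Finset (Fin 3 → ℤ) := Fintype.piFinset fun _ : Fin 3 => Finset.Icc (-(K : ℤ)) K with hbox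
  set F₁ : Finset E3 := (box.filter (fun b => b ≠ 0)).image (latPt G hexFrame) with hF₁
  set F₂ : Finset E3 := box.image (fun b => latPt G hexFrame b + G (hcpShift + ξ)) with hF₂
  have hinj := latPt_hex_injective hG
  have hinj₂ : Function.Injective (fun b : Fin 3 → ℤ => latPt G hexFrame b + G (hcpShift + ξ)) :=
    fun a b h => hinj (add_right_cancel h)
  have hρ : 4 * (4 / 3 * R) ^ 2 < 3 * ((K : ℝ) + 1) ^ 2 := by nlinarith
  rw [finsum_mem_inter_support_eq' F
    {v : E3 | v ≠ 0 ∧ ∃ b : Fin 3 → ℤ, v = latPt G hexFrame b ∨ v = latPt G hexFrame b + G (hcpShift + ξ)} (↑(F₁ ∪ F₂)) ?_]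
  · rw [finsum_mem_coe_finset, Finset.sum_union, Finset.sum_image fun a _ b _ h => hinj h,
      Finset.sum_image fun a _ b _ h => hinj₂ h]
    rw [Finset.disjoint_left]
    intro v hv1 hv2
    obtain ⟨b', -, rfl⟩ := Finset.mem_image.1 hv1
    obtain ⟨b, -, hb⟩ := Finset.mem_image.1 hv2
    exact shifted_ne_unshifted hG hξ b b' hb
  · intro v hv
    have hlt : ‖v‖ < R := lt_of_not_ge fun h => hv (hF _ h)
    simp only [Finset.coe_union, Set.mem_union, Finset.mem_coe, Set.mem_setOf_eq]
    constructor
    · rintro ⟨hv0, b, h | h⟩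
      · refine Or.inl (Finset.mem_image.2 ⟨b, Finset.mem_filter.2 ⟨?_, fun hb0 => hv0 (by rw [h, hb0, latPt_zero])⟩, h.symm⟩)
        have h34 := norm_apply_ge_of_near_one hG (latPt 1 hexFrame b)
        rw [← latPt_eq_apply_one, ← h] at h34
        exact mem_box_of_norm_hexPt_lt' hρ (by linarith)
      · refine Or.inr (Finset.mem_image.2 ⟨b, ?_, h.symm⟩)
        have h34 := norm_apply_ge_of_near_one hG (latPt 1 hexFrame b + hcpShift + ξ)
        rw [← shifted_eq_apply, ← h] at h34
        have htri : ‖latPt 1 hexFrame b + hcpShift‖ ≤ ‖latPt 1 hexFrame b + hcpShift + ξ‖ + ‖ξ‖ := by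
          calc ‖latPt 1 hexFrame b + hcpShift‖ = ‖(latPt 1 hexFrame b + hcpShift + ξ) - ξ‖ := by rw [add_sub_cancel_right]
            _ ≤ ‖latPt 1 hexFrame b + hcpShift + ξ‖ + ‖ξ‖ := norm_sub_le _ _
        exact mem_box_of_norm_hexPt_add_shift_lt' hK2 (by linarith)
    · rintro (h1 | h2)
      · obtain ⟨b, hb, rfl⟩ := Finset.mem_image.1 h1
        have hb0 : b ≠ 0 := (Finset.mem_filter.1 hb).2
        exact ⟨fun h => hb0 (hinj (by rw [h, latPt_zero])), b, Or.inl rfl⟩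
      · obtain ⟨b, -, rfl⟩ := Finset.mem_image.1 h2
        refine ⟨fun h => ?_, b, Or.inr rfl⟩
        have hpos := norm_shifted_gt hG hξ b
        rw [h, norm_zero] at hpos
        linarith

/-! ## §3. The windowed sums of the force prune (P3): window `‖v‖ ≤ 7`, honest box `[−11, 11]³` -/

/-- Moving a window into the integrand: `∑ᶠ v ∈ {v ≠ 0 ∧ ‖v‖ ≤ 7 ∧ v ∈ T}, f v = ∑ᶠ v ∈ {v ≠ 0 ∧ v ∈ T}, 𝟙[‖v‖ ≤ 7]·f v`. [folklore] -/
theorem finsum_window_eq {T : Set E3} (f : E3 → ℝ) :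
    ∑ᶠ v ∈ {v : E3 | v ≠ 0 ∧ ‖v‖ ≤ 7 ∧ v ∈ T}, f v = ∑ᶠ v ∈ {v : E3 | v ≠ 0 ∧ v ∈ T}, (if ‖v‖ ≤ 7 then f v else 0) := by
  rw [finsum_mem_def, finsum_mem_def]
  congr 1
  funext v
  by_cases hv0 : v = 0
  · simp [Set.indicator, hv0]
  · by_cases hv7 : ‖v‖ ≤ 7
    · by_cases hvT : v ∈ T <;> simp [Set.indicator, hv0, hv7, hvT]
    · by_cases hvT : v ∈ T <;> simp [Set.indicator, hv0, hv7, hvT]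

/-- ★★ **Windowed enumeration, fcc** (`‖G − 1‖ ≤ 1/4`; ANY `f`):
`∑ᶠ v ∈ {v ≠ 0 ∧ ‖v‖ ≤ 7 ∧ v ∈ G·L_fcc}, f v = Σ_{b ∈ [−11,11]³ ∖ 0, ‖latPt G fccVec b‖ ≤ 7} f (latPt G fccVec b)`. [folklore] -/
theorem windowSum_fcc_eq_boxSum {G : E3 →L[ℝ] E3} (hG : ‖G - 1‖ ≤ 1 / 4) (f : E3 → ℝ) :
    ∑ᶠ v ∈ {v : E3 | v ≠ 0 ∧ ‖v‖ ≤ 7 ∧ v ∈ {v : E3 | ∃ b : Fin 3 → ℤ, v = latPt G fccVec b}}, f v =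
      ∑ b ∈ ((Fintype.piFinset fun _ : Fin 3 => Finset.Icc (-11 : ℤ) 11).filter (fun b => b ≠ 0)).filter
        (fun b => ‖latPt G fccVec b‖ ≤ 7), f (latPt G fccVec b) := by
  rw [finsum_window_eq]
  have h := finsum_fcc_eq_boxSum hG (F := fun v : E3 => if ‖v‖ ≤ 7 then f v else 0) (R := 71 / 10)
    (fun v hv => by have : ¬‖v‖ ≤ 7 := fun h => by linarith
                    simp [this]) (K := 11) (by norm_num)
  have hset : {v : E3 | v ≠ 0 ∧ v ∈ {v : E3 | ∃ b : Fin 3 → ℤ, v = latPt G fccVec b}} =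
      {v : E3 | v ≠ 0 ∧ ∃ b : Fin 3 → ℤ, v = latPt G fccVec b} := rfl
  simp only [Nat.cast_ofNat] at h
  rw [hset, h, ← Finset.sum_filter]

/-- ★★ **Windowed enumeration, hcp** (`‖G − 1‖ ≤ 1/4`, `‖ξ‖ ≤ 1/4`; ANY `f`): `∑ᶠ v ∈ {v ≠ 0 ∧ ‖v‖ ≤ 7 ∧ v ∈ T_A}, f v =
Σ_{b ∈ [−11,11]³ ∖ 0, ‖latPt G hexFrame b‖ ≤ 7} f (latPt G hexFrame b) + Σ_{b ∈ [−11,11]³, ‖latPt G hexFrame b + G (hcpShift + ξ)‖ ≤ 7} f (…)`. [folklore] -/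
theorem windowSum_hcp_eq_boxSum {G : E3 →L[ℝ] E3} {ξ : E3} (hG : ‖G - 1‖ ≤ 1 / 4) (hξ : ‖ξ‖ ≤ 1 / 4) (f : E3 → ℝ) :
    ∑ᶠ v ∈ {v : E3 | v ≠ 0 ∧ ‖v‖ ≤ 7 ∧
        v ∈ {v : E3 | ∃ b : Fin 3 → ℤ, v = latPt G hexFrame b ∨ v = latPt G hexFrame b + G (hcpShift + ξ)}}, f v =
      ∑ b ∈ ((Fintype.piFinset fun _ : Fin 3 => Finset.Icc (-11 : ℤ) 11).filter (fun b => b ≠ 0)).filter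
          (fun b => ‖latPt G hexFrame b‖ ≤ 7), f (latPt G hexFrame b) +
        ∑ b ∈ (Fintype.piFinset fun _ : Fin 3 => Finset.Icc (-11 : ℤ) 11).filter
          (fun b => ‖latPt G hexFrame b + G (hcpShift + ξ)‖ ≤ 7), f (latPt G hexFrame b + G (hcpShift + ξ)) := by
  rw [finsum_window_eq]
  have h := finsum_hcp_eq_boxSum hG hξ (F := fun v : E3 => if ‖v‖ ≤ 7 then f v else 0) (R := 71 / 10)
    (fun v hv => by have : ¬‖v‖ ≤ 7 := fun h => by linarith
                    simp [this]) (K := 11) (by norm_num) (by norm_num)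
  have hset : {v : E3 | v ≠ 0 ∧ v ∈ {v : E3 | ∃ b : Fin 3 → ℤ, v = latPt G hexFrame b ∨ v = latPt G hexFrame b + G (hcpShift + ξ)}} =
      {v : E3 | v ≠ 0 ∧ ∃ b : Fin 3 → ℤ, v = latPt G hexFrame b ∨ v = latPt G hexFrame b + G (hcpShift + ξ)} := rfl
  simp only [Nat.cast_ofNat] at h
  rw [hset, h, ← Finset.sum_filter, ← Finset.sum_filter]

end Summit.AtomisticToContinuum.Crystallization.Theorems.FrustratedLawDichotomyStrainedPatchHomLatticeBoxWindow

end
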